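import Mathlib
import Summits.ResolutionOfSingularities.ResolutionOfSingularities.Theorems.WildQuotientsWildQuotientResolutionToricChartWords

/-!
# Toric chart certificates — monomial ideals of a presented cone ring: membership is a condition on exponents

(crux stmt-ResolutionOfSingularities-15640 `WildQuotients.WildQuotientResolution`, line `Sketch`,
sector `|G| = p`; RUNG V5 brick B5/HP₀ of `L/w45c/CHAIN.md` v8.1, plan-1 RULING v8.4 (β″): the
second centre of the `J₅` exit is the colon ideal sheaf `(𝓘_T² : 𝓘_{C_a})`, and on the `μ₄` piece
the brick owes the RING identities `(I_A² : 𝔪) = I_A^{(2)}` and `I_A^{(3)} = I_A · I_A^{(2)}` in the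
presented cone ring. This file (part 2/2) reduces such identities between MONOMIAL ideals of
`A = ToricChart.Ring k P D` (ideals generated by word classes) to DECIDABLE statements about
exponent vectors. [OURS · L1 W4.5c] — NOT a statement of any manuscript; replaces the role of no
printed item. Prover res-L1-w45c-stub-4 (gen 4).)

Fix a decidable description `S` of the exponent semigroup of the cone (`S (wordExp D w)` for every
word, every `e` with `S e` is a `wordExp`, `S` additively closed; e.g. a congruence for a cyclic
quotient). For a word family `G : Fin m → Word d r` let `I_G = spanWords k P D G = (wordElem (G l))_l`
and `EG S D G = {e | ∃ l, wordExp (G l) ≤ e ∧ S (e − wordExp (G l))}` (decidable membership).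

* `mem_spanWords_iff` — **`f ∈ I_G ↔` every monomial of `θ f` has distinguished exponent in
  `EG S D G`** (monomial ideals are spanned by monomials);
* `mem_colon_spanWords_iff`, `support_theta_mul_wordElem` — colon by a monomial ideal, shifts;
* `spanWords_eq_of_forall` / `_of_generators`, `spanWords_mul_spanWords`,
  `colon_spanWords_eq_of_forall` — equality / product / colon of monomial ideals from
  exponent-level statements;
* `box_induction` — «finite box + coordinate periodicity» induction for exponent statements.
-/

-- single-problem summit: the doubled namespace component `ResolutionOfSingularities` is forced
set_option linter.dupNamespace false

noncomputable section

open MvPolynomial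

namespace Summit.ResolutionOfSingularities.ResolutionOfSingularities.Theorems.WildQuotientResolution.ToricChart

variable {d r : ℕ}

/-! ## Decidable exponent-level membership -/

/-- `e ∈ wordExp (G l) + S` for some `l`: the exponent-level shadow of the monomial ideal `I_G`,
decidable when `S` is. [OURS · L1 W4.5c] -/
def EG (S : (Fin d → ℕ) → Prop) (D : ConeDatum d r) {m : ℕ} (G : Fin m → Word d r) :
    Set (Fin d → ℕ) :=
  {e | ∃ l : Fin m, (∀ t, wordExp D (G l) t ≤ e t) ∧ S (fun t => e t - wordExp D (G l) t)}

/-- Membership in `EG S D G` is decidable for decidable `S`. [OURS · L1 W4.5c] -/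
instance decMemEG (S : (Fin d → ℕ) → Prop) [DecidablePred S] (D : ConeDatum d r) {m : ℕ}
    (G : Fin m → Word d r) (e : Fin d → ℕ) : Decidable (e ∈ EG S D G) := by
  change Decidable (∃ l : Fin m, (∀ t, wordExp D (G l) t ≤ e t) ∧ S (fun t => e t - wordExp D (G l) t))
  infer_instance

section Exponents

variable {S : (Fin d → ℕ) → Prop} {D : ConeDatum d r} {m : ℕ} {G : Fin m → Word d r}

/-- `EG` from an explicit decomposition. [OURS · L1 W4.5c] -/
theorem EG.of_eq (l : Fin m) {e s : Fin d → ℕ} (hs : S s) (he : e = wordExp D (G l) + s) :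
    e ∈ EG S D G := by
  subst he
  refine ⟨l, fun t => Nat.le_add_right _ _, ?_⟩
  convert hs using 1
  funext t
  simp

/-- Decomposition from `EG`. [OURS · L1 W4.5c] -/
theorem EG.exists_eq {e : Fin d → ℕ} (h : e ∈ EG S D G) :
    ∃ l s, S s ∧ e = wordExp D (G l) + s := by
  obtain ⟨l, hle, hS⟩ := h
  refine ⟨l, _, hS, ?_⟩
  funext t
  simp only [Pi.add_apply]
  exact (Nat.add_sub_cancel' (hle t)).symm

/-- `EG` is stable under adding elements of `S` (`S` additively closed). [OURS · L1 W4.5c] -/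
theorem EG.add (hadd : ∀ a b, S a → S b → S (a + b)) {e s : Fin d → ℕ} (h : e ∈ EG S D G)
    (hs : S s) : (e + s) ∈ EG S D G := by
  obtain ⟨l, s', hs', rfl⟩ := EG.exists_eq h
  exact EG.of_eq l (hadd _ _ hs' hs) (by rw [add_assoc])

/-- Transitivity: if every generator of `G` lies in `EG S G'`, then `EG S G ⊆ EG S G'`.
[OURS · L1 W4.5c] -/
theorem EG.trans (hadd : ∀ a b, S a → S b → S (a + b)) {m' : ℕ} {G' : Fin m' → Word d r}
    (hGG' : ∀ l, (wordExp D (G l)) ∈ EG S D G') {e : Fin d → ℕ} (h : e ∈ EG S D G) :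
    e ∈ EG S D G' := by
  obtain ⟨l, s, hs, rfl⟩ := EG.exists_eq h
  exact EG.add hadd (hGG' l) hs

end Exponents

/-! ## Membership in a monomial ideal is a condition on exponents -/

section Membership

variable {k : Type} [Field k] {P : Type} {D : ConeDatum d r}
variable (S : (Fin d → ℕ) → Prop) (hSw : ∀ w : Word d r, S (wordExp D w))
  (hSe : ∀ e, S e → ∃ w : Word d r, wordExp D w = e)
  (hSadd : ∀ a b, S a → S b → S (a + b))

/-- The monomial ideal of a word family. [OURS · L1 W4.5c] -/
def spanWords (k : Type) [Field k] (P : Type) (D : ConeDatum d r) {m : ℕ} (G : Fin m → Word d r) :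
    Ideal (Ring k P D) :=
  Ideal.span (Set.range fun l => wordElem k P D (G l))

/-- Support of `θ (f · wordElem w)`: shifted by `ιexp (wordExp w)`. [OURS · L1 W4.5c] -/
theorem support_theta_mul_wordElem (f : Ring k P D) (w : Word d r) :
    (theta (f * wordElem k P D w)).support =
      (theta f).support.map (addRightEmbedding (ιexp P (wordExp D w))) := by
  rw [map_mul, theta_wordElem, xmon_eq_monomial, support_mul_monomial_one]

include hSw hSadd in
/-- (⇒) Elements of `I_G` have all exponents in `EG S G`. [OURS · L1 W4.5c] -/
theorem forall_EG_of_mem_spanWords {m : ℕ} (G : Fin m → Word d r) {f : Ring k P D}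
    (hf : f ∈ spanWords k P D G) :
    ∀ mo ∈ (theta f).support, (dist mo) ∈ EG S D G := by
  classical
  induction hf using Submodule.span_induction with
  | mem x hx =>
    obtain ⟨l, rfl⟩ := hx
    intro mo hmo
    rw [theta_wordElem, xmon_eq_monomial] at hmo
    have : mo = ιexp P (wordExp D (G l)) := by
      have h := MvPolynomial.support_monomial_subset hmo
      simpa using h
    subst this
    refine EG.of_eq l (hSw zeroW) ?_
    rw [dist_ιexp, wordExp_zeroW, add_zero]
  | zero => intro mo hmo; simp at hmo
  | add x y _ _ hx hy =>
    intro mo hmo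
    rw [map_add] at hmo
    rcases Finset.mem_union.mp (MvPolynomial.support_add hmo) with h | h
    · exact hx mo h
    · exact hy mo h
  | smul a x hx hax =>
    intro mo hmo
    rw [smul_eq_mul, mul_comm, map_mul] at hmo
    -- `θ x * θ a`: every monomial of the product is a monomial of `θ x` plus one of `θ a`
    obtain ⟨mx, hmx, ma, hma, rfl⟩ := Finset.mem_add.mp (MvPolynomial.support_mul _ _ hmo)
    obtain ⟨wa, hwa⟩ := exists_word_of_mem_support a ma hma
    have h1 := hax mx hmx
    rw [dist_add, ← hwa]
    exact EG.add hSadd h1 (hSw wa)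

include hSe in
/-- (⇐) If all exponents of `θ f` lie in `EG S G` then `f ∈ I_G`: `θ f` is the image of an explicit
combination of word classes times passenger monomials. [OURS · L1 W4.5c] -/
theorem mem_spanWords_of_forall_EG {m : ℕ} (G : Fin m → Word d r) {f : Ring k P D}
    (hf : ∀ mo ∈ (theta f).support, (dist mo) ∈ EG S D G) : f ∈ spanWords k P D G := by
  classical
  -- choose, for every monomial, a generator and a complementary word
  have hch : ∀ mo ∈ (theta f).support, ∃ (l : Fin m) (w : Word d r),
      dist mo = wordExp D (G l) + wordExp D w := by
    intro mo hmo
    obtain ⟨l, s, hs, he⟩ := EG.exists_eq (hf mo hmo)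
    obtain ⟨w, rfl⟩ := hSe s hs
    exact ⟨l, w, he⟩
  by_cases hsupp : (theta f).support = ∅
  · have h0 : theta f = 0 := MvPolynomial.support_eq_empty.mp hsupp
    rw [← map_zero (theta (k := k) (P := P) (D := D))] at h0
    rw [theta_injective h0]
    exact Ideal.zero_mem _
  obtain ⟨mo₀, hmo₀⟩ := Finset.nonempty_iff_ne_empty.mpr hsupp
  obtain ⟨l₀, _, _⟩ := hch mo₀ hmo₀
  haveI : Nonempty (Fin m) := ⟨l₀⟩
  haveI : Nonempty (Word d r) := ⟨zeroW⟩
  choose! l w hlw using hch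
  let g : Ring k P D := ∑ mo ∈ (theta f).support,
    (theta f).coeff mo • (wordElem k P D (G (l mo)) *
      (wordElem k P D (w mo) * Ideal.Quotient.mk _ (pmonY (mo - ιexp P (dist mo)))))
  have hg : g ∈ spanWords k P D G := by
    refine Ideal.sum_mem _ fun mo _ => ?_
    rw [Algebra.smul_def, ← mul_assoc, mul_comm (algebraMap _ _ _), mul_assoc]
    exact Ideal.mul_mem_right _ _ (Ideal.subset_span ⟨l mo, rfl⟩)
  have hθg : theta g = theta f := by
    rw [map_sum]
    conv_rhs => rw [(theta f).as_sum]
    refine Finset.sum_congr rfl fun mo hmo => ?_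
    rw [map_smul, map_mul, map_mul, theta_wordElem, theta_wordElem, theta_mk, presentation_pmonY _
      (sub_ιexp_dist_inl mo), xmon_eq_monomial, xmon_eq_monomial, monomial_mul, monomial_mul,
      one_mul, one_mul, ← add_assoc, ← ιexp_add, ← hlw mo hmo, ιexp_dist_add_sub, smul_monomial,
      smul_eq_mul, mul_one]
  have : f = g := theta_injective (hθg.symm)
  rw [this]
  exact hg

include hSw hSe hSadd in
/-- **Membership in a monomial ideal is a condition on exponents.** [OURS · L1 W4.5c] -/
theorem mem_spanWords_iff {m : ℕ} (G : Fin m → Word d r) (f : Ring k P D) :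
    f ∈ spanWords k P D G ↔ ∀ mo ∈ (theta f).support, (dist mo) ∈ EG S D G :=
  ⟨forall_EG_of_mem_spanWords S hSw hSadd G, mem_spanWords_of_forall_EG S hSe G⟩

include hSw hSe hSadd in
/-- **Two monomial ideals agree if their exponent shadows agree on `S`.** [OURS · L1 W4.5c] -/
theorem spanWords_eq_of_forall {m m' : ℕ} (G : Fin m → Word d r) (G' : Fin m' → Word d r)
    (h : ∀ e, S e → (e ∈ EG S D G ↔ e ∈ EG S D G')) : spanWords k P D G = spanWords k P D G' := by
  ext f
  rw [mem_spanWords_iff S hSw hSe hSadd G, mem_spanWords_iff S hSw hSe hSadd G']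
  refine forall₂_congr fun mo hmo => ?_
  obtain ⟨w, hw⟩ := exists_word_of_mem_support f mo hmo
  rw [← hw]
  exact h _ (hSw w)

include hSw hSe hSadd in
/-- Two monomial ideals agree if each generator of one lies in the shadow of the other.
[OURS · L1 W4.5c] -/
theorem spanWords_eq_of_generators {m m' : ℕ} (G : Fin m → Word d r) (G' : Fin m' → Word d r)
    (h₁ : ∀ l, (wordExp D (G l)) ∈ EG S D G') (h₂ : ∀ l', (wordExp D (G' l')) ∈ EG S D G) :
    spanWords k P D G = spanWords k P D G' :=
  spanWords_eq_of_forall S hSw hSe hSadd G G' fun _ _ =>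
    ⟨fun h => EG.trans hSadd h₁ h, fun h => EG.trans hSadd h₂ h⟩

/-- The product family of two word families. [OURS · L1 W4.5c] -/
def prodWords {m m' : ℕ} (G : Fin m → Word d r) (G' : Fin m' → Word d r) :
    Fin (m * m') → Word d r :=
  fun i => addW (G (finProdFinEquiv.symm i).1) (G' (finProdFinEquiv.symm i).2)

/-- **Product of monomial ideals**: `I_G · I_{G'} = I_{G ⊗ G'}`. [OURS · L1 W4.5c] -/
theorem spanWords_mul_spanWords {m m' : ℕ} (G : Fin m → Word d r) (G' : Fin m' → Word d r) :
    spanWords k P D G * spanWords k P D G' = spanWords k P D (prodWords G G') := by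
  rw [spanWords, spanWords, Ideal.span_mul_span', spanWords]
  congr 1
  ext x
  simp only [Set.mem_mul, Set.mem_range, prodWords]
  constructor
  · rintro ⟨_, ⟨i, rfl⟩, _, ⟨j, rfl⟩, rfl⟩
    refine ⟨finProdFinEquiv (i, j), ?_⟩
    rw [Equiv.symm_apply_apply, wordElem_addW]
  · rintro ⟨i, rfl⟩
    exact ⟨_, ⟨_, rfl⟩, _, ⟨_, rfl⟩, (wordElem_addW _ _).symm⟩

/-- **Colon by a monomial ideal**: `f ∈ (I : I_U) ↔ ∀ i, f · wordElem (U i) ∈ I`.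
[OURS · L1 W4.5c] -/
theorem mem_colon_spanWords_iff (I : Ideal (Ring k P D)) {n : ℕ} (U : Fin n → Word d r)
    (f : Ring k P D) :
    f ∈ I.colon (spanWords k P D U : Set (Ring k P D)) ↔ ∀ i, f * wordElem k P D (U i) ∈ I := by
  rw [Submodule.mem_colon]
  constructor
  · intro h i
    have := h (wordElem k P D (U i)) (Ideal.subset_span ⟨i, rfl⟩)
    rwa [smul_eq_mul] at this
  · intro h x hx
    rw [smul_eq_mul, mul_comm]
    change x ∈ spanWords k P D U at hx
    induction hx using Submodule.span_induction with
    | mem y hy => obtain ⟨i, rfl⟩ := hy; rw [mul_comm]; exact h i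
    | zero => rw [zero_mul]; exact I.zero_mem
    | add y z _ _ hy hz => rw [add_mul]; exact I.add_mem hy hz
    | smul a y _ hy => rw [smul_eq_mul, mul_assoc]; exact I.mul_mem_left a hy

include hSw hSe hSadd in
/-- **Colon of monomial ideals from an exponent-level statement**: if for every `e ∈ S`,
`(∀ i, EG S G (e + wordExp (U i))) ↔ EG S G' e`, then `(I_G : I_U) = I_{G'}`. [OURS · L1 W4.5c] -/
theorem colon_spanWords_eq_of_forall {m n m' : ℕ} (G : Fin m → Word d r) (U : Fin n → Word d r)
    (G' : Fin m' → Word d r)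
    (h : ∀ e, S e → ((∀ i, (e + wordExp D (U i)) ∈ EG S D G) ↔ e ∈ EG S D G')) :
    (spanWords k P D G).colon (spanWords k P D U : Set (Ring k P D)) = spanWords k P D G' := by
  classical
  ext f
  rw [mem_colon_spanWords_iff, mem_spanWords_iff S hSw hSe hSadd G']
  constructor
  · intro hf mo hmo
    obtain ⟨w, hw⟩ := exists_word_of_mem_support f mo hmo
    rw [← hw]
    refine (h _ (hSw w)).mp fun i => ?_
    have hi := (mem_spanWords_iff S hSw hSe hSadd G _).mp (hf i)
    have hmem : mo + ιexp P (wordExp D (U i)) ∈ (theta (f * wordElem k P D (U i))).support := by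
      rw [support_theta_mul_wordElem]
      exact Finset.mem_map_of_mem _ hmo
    have h2 := hi _ hmem
    rwa [dist_add, dist_ιexp, ← hw] at h2
  · intro hf i
    rw [mem_spanWords_iff S hSw hSe hSadd G]
    intro mo' hmo'
    rw [support_theta_mul_wordElem, Finset.mem_map] at hmo'
    obtain ⟨mo, hmo, rfl⟩ := hmo'
    rw [addRightEmbedding_apply, dist_add, dist_ιexp]
    obtain ⟨w, hw⟩ := exists_word_of_mem_support f mo hmo
    have h1 : (wordExp D w) ∈ EG S D G' := by rw [hw]; exact hf mo hmo
    have h2 := (h _ (hSw w)).mpr h1 i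
    rwa [hw] at h2

end Membership

/-! ## Box-plus-periodicity induction for exponent statements -/

/-- **Box induction**: a property of exponent vectors that holds on the finite box
`{e | ∀ i, e i < N i}` and is inherited from `e − c i • δ_i` whenever `e i ≥ N i` (`0 < c i ≤ N i`)
holds everywhere. [folklore] -/
theorem box_induction (N c : Fin d → ℕ) (hc : ∀ i, 0 < c i ∧ c i ≤ N i) (Q : (Fin d → ℕ) → Prop)
    (hbox : ∀ e, (∀ i, e i < N i) → Q e)
    (hstep : ∀ e i, N i ≤ e i → Q (fun t => if t = i then e t - c i else e t) → Q e) :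
    ∀ e, Q e := by
  intro e
  induction' hn : ∑ t, e t using Nat.strong_induction_on with n ih generalizing e
  by_cases hb : ∀ i, e i < N i
  · exact hbox e hb
  · push Not at hb
    obtain ⟨i, hi⟩ := hb
    apply hstep e i hi
    apply ih (∑ t, (fun t => if t = i then e t - c i else e t) t) _ _ rfl
    rw [← hn]
    apply Finset.sum_lt_sum
    · intro t _
      split_ifs
      · exact Nat.sub_le _ _
      · exact le_rfl
    · refine ⟨i, Finset.mem_univ i, ?_⟩
      simp only [if_true]
      have := hc i
      omega

end Summit.ResolutionOfSingularities.ResolutionOfSingularities.Theorems.WildQuotientResolution.ToricChart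

end
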